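/-
Copyright (c) 2026. Released under the Apache 2.0 license.
-/
import Literature.NumberTheory.EllipticCurves.NewformCuspFourierValuation
import HarnessLib

/-!
# `p`-adic valuations of the Fourier expansions of weight-`k` newforms on `Γ₀(N)` at ALL cusps
# (Česnavičius–Neururer–Saha, JEMS 26 (2024), Thm. 4.6 and Lemma 5.13 = Thm. 1.3)

The source. K. Česnavičius, M. Neururer, A. Saha, *The Manin constant and the modular degree*,
J. Eur. Math. Soc. 26 (2024), no. 2, 573–637 (bib key `CesnaviciusNeururerSaha2023`; full text
held as `paper:url-5d7cab36bb8f` = the authors' final version of 27 March 2022, 51 pp.; page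
locators below refer to it). This file is the sequel of `NewformCuspFourierValuation.lean`, which
transcribed the WEIGHT-`2` case (Cor. 4.7, p. 31) and left the general-weight theorem as a
`TODO(general form)`. Here we transcribe, in the same vocabulary (`cuspDenominator N γ = L`,
`fourierCoeffAtCusp N k f γ n = a_f(n;γ)`, `ι : ℚ̄_p ≃ ℂ`, `‖p‖ = p⁻¹` on `PadicAlgCl p`, so that
"`val_p(x) ≥ B`" is "`‖ι⁻¹ x‖ ≤ p^{-B}`" — see the module docstring of the weight-`2` file):

* **Thm. 4.6** (p. 30; = the bounds of Thm. 1.3, p. 4), all weights `k`, both printed displays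
  (the all-`p` brace and the sharper `p = 2` brace) — the named fact
  `cesnaviciusNeururerSaha_thm_4_6` (statement only);
* **Lemma 5.13** (pp. 38–39; = the "Moreover" clause of Thm. 1.3), its analytic content
  "`val_p(f|𝔠)` depends only on `f` and `val_p(L)`" for modular forms of weight `k ≥ 1` on
  `Γ₀(N)` — the named fact `cesnaviciusNeururerSaha_lemma_5_13` (statement only);
* PROVED: Cor. 4.7 IS the weight-`2` case of Thm. 4.6
  (`cesnaviciusNeururerSaha_cor_4_7_of_thm_4_6`, so the weight-`2` fact of the earlier file is now
  DERIVED from this one); (4.5.1) "if `p ∤ N`, then `val_p(f|𝔠) ≥ 0`" in every weight; integrality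
  at `∞` in every weight; the squarefree-level shape; and **Thm. 1.3** (p. 4) assembled verbatim
  from the two facts (`cesnaviciusNeururerSaha_thm_1_3`).

## The printed statements, verbatim

**Theorem 4.6** (p. 30). "For a prime `p`, a cuspform `f` that is a `ℤ`-linear combination of
normalized newforms of weight `k` on `Γ₀(N)`, a cusp `𝔠 ∈ X₀(N)(ℂ)` of denominator `L`, and an
isomorphism `ℂ ≃ ℚ̄_p`,
`val_p(f|𝔠) ≥ -(k/2) val_p(N / gcd(L², N)) + { 0 if val_p(gcd(L, N/L)) = 0;  0 if
val_p(gcd(L, N/L)) = 1, val_p(N) > 2;  -½ if val_p(L) = ½ val_p(N) = 1;  1 - ½ val_p(gcd(L, N/L))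
otherwise }`,
as well as the following stronger bounds in the case `p = 2`:
`val_2(f|𝔠) ≥ -(k/2) val_2(N / gcd(L², N)) + { 0 if val_2(L) = ½ val_2(N) = 1;  k/2 if
val_2(L) = ½ val_2(N) ∈ {2, 3, 4};  k/2 + 1 - ¼ val_2(N) if val_2(L) = ½ val_2(N) > 4;  0 if
val_2(gcd(L, N/L)) = 3, val_2(N) > 6 }`."
Here (4.2.2, p. 29) `val_p(f|𝔠) := inf_{n ≥ 0} val_p(a_f(n;γ))` for any `γ ∈ SL₂(ℤ)` with
`𝔠 = γ∞`, and (§4.2, p. 28) `k ∈ ℤ_{>0}`.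

**Lemma 5.13** (pp. 38–39). "For a prime `p`, an `f ∈ H⁰(X₀(N)_{ℚ̄_p}, ω^{⊗k})` with `k ≥ 1`, a
cusp `𝔠 ∈ X₀(N)(ℚ̄_p)` of denominator `L`, and an isomorphism `ι : ℚ̄_p ≃ ℂ`, the valuation
`v := val_p(ι(f)|ι(𝔠))` defined as in (4.2.2) … depends only on `f` and `val_p(L)` (and not on
`𝔠`, `ι`, `Ñ`, or `𝔠̃`)" (§5.5, p. 35: `H⁰((X_Γ)_ℂ, ω^{⊗k})` "is canonically identified with the
`ℂ`-vector space of modular forms … of weight `k` on `Γ` reviewed in §4.2").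

**Theorem 1.3** (p. 4; "Theorem 4.6 and Lemma 5.13"). "For a prime `p`, a cuspidal, normalized
newform `f` of weight `k` on `Γ₀(N)`, an isomorphism `ℂ ≃ ℚ̄_p`, the resulting
`val_p : ℂ → ℚ ∪ {∞}` with `val_p(p) = 1`, and a cusp `𝔠 ∈ X₀(N)(ℂ)` of denominator `L` (see
§4.1), the Fourier coefficients `a_f(r; 𝔠)` satisfy [the two displays of Thm. 4.6 with
`val_p(a_f(r; 𝔠))` in place of `val_p(f|𝔠)`]. Moreover, `min_r(val_p(a_f(r; 𝔠)))` only depends on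
`f` and `L`, and not on the cusp `𝔠` with denominator `L`."

## Rendering

* The right-hand sides are EXPONENTS: "`val_p(a_f(n;γ)) ≥ -A + B` for all `n`" is
  "`‖ι⁻¹(a_f(n;γ))‖ ≤ p ^ (A - B)` for all `n`". The braces are the functions
  `cesnaviciusNeururerSahaBraceK v_G v_L v_N` (all `p`) and
  `cesnaviciusNeururerSahaBraceTwo k v_G v_L v_N` (`p = 2`) of the three valuations that occur in
  print, `v_G = val_p(gcd(L, N/L))`, `v_L = val_p(L)`, `v_N = val_p(N)`, rows in the printed order
  (first applicable row wins; the printed rows are pairwise exclusive anyway); the exponents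
  `cesnaviciusNeururerSahaExponentK k p N L = (k/2)·val_p(N/gcd(L², N)) - brace` and
  `cesnaviciusNeururerSahaExponentTwo` feed them the LITERAL quantities `padicValNat p (N / gcd(L²,
  N))`, `padicValNat p (gcd(L, N/L))`, `padicValNat p L`, `padicValNat p N` (no pre-simplification;
  the simplifications `val_p(N/gcd(L²,N)) = v_N - min(2v_L, v_N)` and `val_p(gcd(L,N/L)) =
  min(v_L, v_N - v_L)` for `L ∣ N ≠ 0` are PROVED below, `padicValNat_level_div_gcd_sq_eq`,
  `padicValNat_gcd_level_div_eq`).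
* The `p = 2` display lists four cases and no "otherwise" row: outside its four rows the first
  display (valid for every `p`, so also for `p = 2`) is what the theorem asserts at `p = 2`.
  Accordingly `cesnaviciusNeururerSahaBraceTwo` returns the printed `p = 2` row in the four printed
  cases and the all-`p` brace otherwise, and the fact asserts, for every `p`, the first display, and,
  when `p = 2`, additionally the bound with `cesnaviciusNeururerSahaBraceTwo` — i.e. exactly the
  conjunction of the two printed displays, nothing more (in each of the four cases the `p = 2` row
  is the sharper one; `cesnaviciusNeururerSaha_cor_4_7_of_thm_4_6` re-derives the seven rows of the
  weight-`2` Cor. 4.7 from the two displays, as the paper does: "We explicate the weight 2 case of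
  Theorem 4.6", p. 31).
* "a cuspform `f` that is a `ℤ`-linear combination of normalized newforms of weight `k` on `Γ₀(N)`"
  ↦ `f : CuspForm (Gamma0 N) k`, `f ∈ Submodule.span ℤ (newforms0 N k)` (as in the weight-`2`
  file), `0 < k` (§4.2).
* Lemma 5.13: "depends only on `f` and `val_p(L)` (and not on `𝔠`)" ↦ for a modular form `f` of
  weight `k ≥ 1` on `Γ₀(N)` (`f : ModularForm (Gamma0 N) k`; for fixed `ι` every complex modular
  form is `ι(f)` for a unique `f` over `ℚ̄_p` by flat base change, §5.5, and `ι` preserves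
  denominators of cusps), a fixed `ι`, and two representatives `γ, γ'` of cusps whose denominators
  have the same `p`-adic valuation, every bound `‖ι⁻¹(a_f(n;γ))‖ ≤ B ∀ n` transfers to `γ'` (for
  `B = p^{-v}` this is "`val_p(f|γ∞) ≥ v ⇒ val_p(f|γ'∞) ≥ v`", and by symmetry the two infima
  agree). The independence of `ι` for a FIXED `ℚ̄_p`-form `f` is not a statement about a fixed
  complex form and is not transcribed; neither is the geometric characterisation (5.13.1)
  (no integral model `X₀(N)_{ℤ_p}` in the tree) — `TODO(general form)`.

## What is NOT transcribed (vocabulary absent from the tree; recorded, not paraphrased)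
Lemma 4.4 and Lemma 4.5's second display (local representation `π_{f,p}`, Whittaker newform
`W_{π,ψ}(g_{t,ℓ,v})`), Theorems 3.14/3.15 (local bounds), Prop. 5.12 (differents `d(a,b)`),
Lemma 5.11 (reduction of cusps to components of `X₀(N)_{𝔽_p}`), (5.13.1).

## References
* [CesnaviciusNeururerSaha2023] op. cit., §4.1–4.2 (pp. 28–29), Lemma 4.5 and Thm. 4.6 (p. 30),
  Cor. 4.7 (p. 31), Lemma 5.13 (pp. 38–39), §5.5 (p. 35), Thm. 1.3 (p. 4).
* [DiamondShurman2005] F. Diamond, J. Shurman, *A first course in modular forms*, §3.8 (cusps of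
  `Γ₀(N)`: the cusp `∞` is the class of `γ∞` for `γ ∈ Γ₀(N)`).
-/

noncomputable section

open scoped MatrixGroups ModularForm

open CongruenceSubgroup UpperHalfPlane Complex

namespace Literature.NumberTheory.EllipticCurves.ModularForms

/-! ### Arithmetic of the printed quantities `val_p(N/gcd(L², N))`, `val_p(gcd(L, N/L))` -/

section Valuations

variable {p : ℕ} [hp : Fact p.Prime]

/-- `val_p(gcd(a, b)) = min(val_p(a), val_p(b))` for `a, b ≠ 0` (private arithmetic helper).
[folklore] -/
private theorem padicValNat_gcd_eq_min {a b : ℕ} (ha : a ≠ 0) (hb : b ≠ 0) :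
    padicValNat p (Nat.gcd a b) = min (padicValNat p a) (padicValNat p b) := by
  rw [← Nat.factorization_def _ hp.out, ← Nat.factorization_def _ hp.out,
    ← Nat.factorization_def _ hp.out, Nat.factorization_gcd ha hb]
  rfl

/-- The leading term of Thm. 4.6: `val_p(N / gcd(L², N)) = val_p(N) - min(2 val_p(L), val_p(N))`
(`N, L ≠ 0`). [cite: CesnaviciusNeururerSaha2023, Thm. 4.6 (p. 30); §4.1 width w(𝔠) = N/gcd(L², N)] -/
theorem padicValNat_level_div_gcd_sq_eq {N L : ℕ} (hN : N ≠ 0) (hL : L ≠ 0) :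
    padicValNat p (N / Nat.gcd (L ^ 2) N) =
      padicValNat p N - min (2 * padicValNat p L) (padicValNat p N) := by
  rw [padicValNat.div_of_dvd (Nat.gcd_dvd_right _ _), padicValNat_gcd_eq_min (pow_ne_zero 2 hL) hN,
    padicValNat.pow]

/-- The brace variable of Thm. 4.6: `val_p(gcd(L, N/L)) = min(val_p(L), val_p(N) - val_p(L))` for
`L ∣ N ≠ 0`. [cite: CesnaviciusNeururerSaha2023, Thm. 4.6 (p. 30)] -/
theorem padicValNat_gcd_level_div_eq {N L : ℕ} (hN : N ≠ 0) (hLN : L ∣ N) :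
    padicValNat p (Nat.gcd L (N / L)) =
      min (padicValNat p L) (padicValNat p N - padicValNat p L) := by
  have hL : L ≠ 0 := fun h0 ↦ hN (Nat.eq_zero_of_zero_dvd (h0 ▸ hLN))
  have hNL : N / L ≠ 0 := fun h0 ↦ hN (by simpa [h0] using (Nat.div_mul_cancel hLN).symm)
  rw [padicValNat_gcd_eq_min hL hNL, padicValNat.div_of_dvd hLN]

/-- `val_p(L) ≤ val_p(N)` for `L ∣ N ≠ 0` (private arithmetic helper). [folklore] -/
private theorem padicValNat_le_of_dvd {N L : ℕ} (hN : N ≠ 0) (hLN : L ∣ N) :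
    padicValNat p L ≤ padicValNat p N :=
  (padicValNat_dvd_iff_le hN).mp (pow_padicValNat_dvd.trans hLN)

end Valuations

/-! ### Cusps: the denominator `N` characterises the cusp `∞` -/

/-- ČNS §4.1 (p. 28): "The cusp `∞` is the unique one of denominator `N`": the cusp `γ∞` has
denominator `N` iff `γ ∈ Γ₀(N)` (iff `γ∞` and `∞` are `Γ₀(N)`-equivalent, `∞ = 1·∞`).
[cite: CesnaviciusNeururerSaha2023, §4.1 (p. 28); DiamondShurman2005, §3.8] -/
theorem cuspDenominator_eq_level_iff_mem_Gamma0 (N : ℕ) [NeZero N] (γ : SL(2, ℤ)) :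
    cuspDenominator N γ = N ↔ γ ∈ Gamma0 N := by
  rw [Gamma0_mem, cuspDenominator, Nat.gcd_eq_right_iff_dvd, ← Int.natCast_dvd,
    ZMod.intCast_zmod_eq_zero_iff_dvd]

/-! ### The printed braces and exponents of Thm. 4.6 -/

/-- **The first (all-`p`) brace of ČNS Thm. 4.6** as a function of `v_G = val_p(gcd(L, N/L))`,
`v_L = val_p(L)`, `v_N = val_p(N)`, rows in the printed order: `0` if `v_G = 0`; `0` if `v_G = 1,
v_N > 2`; `-½` if `v_L = ½ v_N = 1` (i.e. `v_L = 1, v_N = 2`); `1 - ½ v_G` otherwise.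
[cite: CesnaviciusNeururerSaha2023, Thm. 4.6 (p. 30), first display; Thm. 1.3 (p. 4)] -/
def cesnaviciusNeururerSahaBraceK (vG vL vN : ℕ) : ℝ :=
  if vG = 0 then 0
  else if vG = 1 ∧ 2 < vN then 0
  else if vL = 1 ∧ vN = 2 then -1 / 2
  else 1 - (vG : ℝ) / 2

/-- **The second (`p = 2`) brace of ČNS Thm. 4.6** as a function of the weight `k` and of
`v_G = val_2(gcd(L, N/L))`, `v_L = val_2(L)`, `v_N = val_2(N)`, rows in the printed order: `0` if
`v_L = ½ v_N = 1`; `k/2` if `v_L = ½ v_N ∈ {2, 3, 4}`; `k/2 + 1 - ¼ v_N` if `v_L = ½ v_N > 4`; `0` if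
`v_G = 3, v_N > 6`; and — the printed `p = 2` display having no "otherwise" row — the all-`p` brace
`cesnaviciusNeururerSahaBraceK v_G v_L v_N` (the first display, which the theorem asserts for every
`p`) in all remaining cases.
[cite: CesnaviciusNeururerSaha2023, Thm. 4.6 (p. 30), second display; Thm. 1.3 (pp. 4–5)] -/
def cesnaviciusNeururerSahaBraceTwo (k : ℤ) (vG vL vN : ℕ) : ℝ :=
  if 2 * vL = vN ∧ vL = 1 then 0
  else if 2 * vL = vN ∧ (vL = 2 ∨ vL = 3 ∨ vL = 4) then (k : ℝ) / 2
  else if 2 * vL = vN ∧ 4 < vL then (k : ℝ) / 2 + 1 - (vN : ℝ) / 4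
  else if vG = 3 ∧ 6 < vN then 0
  else cesnaviciusNeururerSahaBraceK vG vL vN

/-- **The exponent of the first display of Thm. 4.6**: `E = (k/2)·val_p(N/gcd(L², N)) - {brace}`,
so that the display reads `‖ι⁻¹(a_f(n;γ))‖ ≤ p ^ E`, i.e. `val_p(a_f(n;γ)) ≥ -E`, fed with the
literal printed quantities. [cite: CesnaviciusNeururerSaha2023, Thm. 4.6 (p. 30), first display] -/
def cesnaviciusNeururerSahaExponentK (k : ℤ) (p N L : ℕ) : ℝ :=
  (k : ℝ) / 2 * (padicValNat p (N / Nat.gcd (L ^ 2) N) : ℝ) -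
    cesnaviciusNeururerSahaBraceK (padicValNat p (Nat.gcd L (N / L))) (padicValNat p L)
      (padicValNat p N)

/-- **The exponent of the second (`p = 2`) display of Thm. 4.6**:
`E₂ = (k/2)·val_2(N/gcd(L², N)) - {p = 2 brace}` (used at `p = 2` only).
[cite: CesnaviciusNeururerSaha2023, Thm. 4.6 (p. 30), second display] -/
def cesnaviciusNeururerSahaExponentTwo (k : ℤ) (p N L : ℕ) : ℝ :=
  (k : ℝ) / 2 * (padicValNat p (N / Nat.gcd (L ^ 2) N) : ℝ) -
    cesnaviciusNeururerSahaBraceTwo k (padicValNat p (Nat.gcd L (N / L))) (padicValNat p L)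
      (padicValNat p N)

/-! ### Thm. 4.6 (= the bounds of Thm. 1.3), all weights — named fact -/

/-- **Česnavičius–Neururer–Saha 2024, Thm. 4.6 (`p`-adic valuations of the Fourier expansions of
weight-`k` newforms on `Γ₀(N)` at all cusps; = the bounds of Thm. 1.3).** Printed (JEMS 26 (2024),
Thm. 4.6, p. 30 of the authors' final version), verbatim: "For a prime `p`, a cuspform `f` that is
a `ℤ`-linear combination of normalized newforms of weight `k` on `Γ₀(N)`, a cusp `𝔠 ∈ X₀(N)(ℂ)` of
denominator `L`, and an isomorphism `ℂ ≃ ℚ̄_p`, `val_p(f|𝔠) ≥ -(k/2) val_p(N/gcd(L², N)) + {0 if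
val_p(gcd(L, N/L)) = 0; 0 if val_p(gcd(L, N/L)) = 1, val_p(N) > 2; -½ if val_p(L) = ½ val_p(N)
= 1; 1 - ½ val_p(gcd(L, N/L)) otherwise}`, as well as the following stronger bounds in the case
`p = 2`: `val_2(f|𝔠) ≥ -(k/2) val_2(N/gcd(L², N)) + {0 if val_2(L) = ½ val_2(N) = 1; k/2 if
val_2(L) = ½ val_2(N) ∈ {2,3,4}; k/2 + 1 - ¼ val_2(N) if val_2(L) = ½ val_2(N) > 4; 0 if
val_2(gcd(L, N/L)) = 3, val_2(N) > 6}`", where (4.2.2) `val_p(f|𝔠) := inf_{n ≥ 0}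
val_p(a_f(n;γ))` for any `γ ∈ SL₂(ℤ)` with `𝔠 = γ∞` and `k ∈ ℤ_{>0}` (§4.2). Rendering (module
docstring): for every level `N ≥ 1`, prime `p`, weight `k > 0`, `f ∈ S_k(Γ₀(N))` in the `ℤ`-span of
`newforms0 N k`, every `γ ∈ SL(2, ℤ)` (cusp `γ∞`, `L = cuspDenominator N γ`), every ring isomorphism
`ι : ℚ̄_p ≃ ℂ` and every `n`: `‖ι⁻¹(a_f(n;γ))‖ ≤ p ^ cesnaviciusNeururerSahaExponentK k p N L`
(first display) and, if `p = 2`, also `‖ι⁻¹(a_f(n;γ))‖ ≤ p ^ cesnaviciusNeururerSahaExponentTwo k p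
N L` (second display). FAITHFUL to print. Named fact (statement only); its weight-`2` case is
Cor. 4.7 (`cesnaviciusNeururerSaha_cor_4_7_of_thm_4_6`).
[cite: CesnaviciusNeururerSaha2023, Thm. 4.6 (p. 30); Thm. 1.3 (pp. 4–5)] -/
def cesnaviciusNeururerSaha_thm_4_6 : Prop :=
  ∀ (N : ℕ) [NeZero N] (p : ℕ) [Fact p.Prime] (k : ℤ), 0 < k →
    ∀ (f : CuspForm (Gamma0 N) k), f ∈ Submodule.span ℤ (newforms0 N k) →
    ∀ (γ : SL(2, ℤ)) (ι : PadicAlgCl p ≃+* ℂ) (n : ℕ),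
      ‖ι.symm (fourierCoeffAtCusp N k ⇑f γ n)‖ ≤
          (p : ℝ) ^ cesnaviciusNeururerSahaExponentK k p N (cuspDenominator N γ) ∧
      (p = 2 → ‖ι.symm (fourierCoeffAtCusp N k ⇑f γ n)‖ ≤
          (p : ℝ) ^ cesnaviciusNeururerSahaExponentTwo k p N (cuspDenominator N γ))

/-! ### Cor. 4.7 is the weight-`2` case of Thm. 4.6 (proved) -/

section Bridge

/-- Unfolding the first exponent at `L ∣ N ≠ 0` in terms of `v_L = val_p(L)`, `v_N = val_p(N)`:
`E = (k/2)(v_N - min(2v_L, v_N)) - brace(min(v_L, v_N - v_L), v_L, v_N)`.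
[cite: CesnaviciusNeururerSaha2023, Thm. 4.6 (p. 30)] -/
theorem cesnaviciusNeururerSahaExponentK_eq {p : ℕ} [Fact p.Prime] (k : ℤ) {N L : ℕ} (hN : N ≠ 0)
    (hLN : L ∣ N) :
    cesnaviciusNeururerSahaExponentK k p N L =
      (k : ℝ) / 2 * ((padicValNat p N - min (2 * padicValNat p L) (padicValNat p N) : ℕ) : ℝ) -
        cesnaviciusNeururerSahaBraceK (min (padicValNat p L) (padicValNat p N - padicValNat p L))
          (padicValNat p L) (padicValNat p N) := by
  have hL : L ≠ 0 := fun h0 ↦ hN (Nat.eq_zero_of_zero_dvd (h0 ▸ hLN))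
  rw [cesnaviciusNeururerSahaExponentK, padicValNat_level_div_gcd_sq_eq hN hL,
    padicValNat_gcd_level_div_eq hN hLN]

/-- The same for the `p = 2` exponent. [cite: CesnaviciusNeururerSaha2023, Thm. 4.6 (p. 30)] -/
theorem cesnaviciusNeururerSahaExponentTwo_eq {p : ℕ} [Fact p.Prime] (k : ℤ) {N L : ℕ}
    (hN : N ≠ 0) (hLN : L ∣ N) :
    cesnaviciusNeururerSahaExponentTwo k p N L =
      (k : ℝ) / 2 * ((padicValNat p N - min (2 * padicValNat p L) (padicValNat p N) : ℕ) : ℝ) -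
        cesnaviciusNeururerSahaBraceTwo k
          (min (padicValNat p L) (padicValNat p N - padicValNat p L))
          (padicValNat p L) (padicValNat p N) := by
  have hL : L ≠ 0 := fun h0 ↦ hN (Nat.eq_zero_of_zero_dvd (h0 ▸ hLN))
  rw [cesnaviciusNeururerSahaExponentTwo, padicValNat_level_div_gcd_sq_eq hN hL,
    padicValNat_gcd_level_div_eq hN hLN]

/-- Row-by-row comparison, `p` odd: the Cor. 4.7 brace is at most `val_p(gcd(L, N/L))` plus the
first brace of Thm. 4.6 (in fact equal). [cite: CesnaviciusNeururerSaha2023, Cor. 4.7 (p. 31)] -/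
theorem cesnaviciusNeururerSahaCuspBound_le_add_braceK {p vL vN : ℕ} (hp : p.Prime) (hp2 : p ≠ 2)
    (hle : vL ≤ vN) :
    cesnaviciusNeururerSahaCuspBound p vL vN ≤
      (min vL (vN - vL) : ℕ) + cesnaviciusNeururerSahaBraceK (min vL (vN - vL)) vL vN := by
  have hp3 : (3 : ℝ) ≤ p := by
    have h2 := hp.two_le
    exact_mod_cast (show 3 ≤ p by omega)
  unfold cesnaviciusNeururerSahaCuspBound
  split_ifs with c1 c2 c3 c4 c5 c6
  · -- row 1 of Cor. 4.7 / row 1 of Thm. 4.6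
    have hG : min vL (vN - vL) = 0 := by omega
    rw [hG, cesnaviciusNeururerSahaBraceK, if_pos rfl]
    simp
  · -- row 2 of Cor. 4.7 (`v_L = 1, v_N = 2`) / row 3 of Thm. 4.6 (`p ≥ 3`: `1/(p-1) ≤ 1/2`)
    obtain ⟨rfl, rfl⟩ := c2
    rw [show min 1 (2 - 1) = 1 by norm_num, cesnaviciusNeururerSahaBraceK, if_neg one_ne_zero,
      if_neg (by omega), if_pos ⟨rfl, rfl⟩]
    refine max_le (by norm_num) ?_
    have h1 : (0 : ℝ) < (p : ℝ) - 1 := by linarith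
    rw [div_le_iff₀ h1]
    push_cast
    linarith
  · -- row 3 of Cor. 4.7 / row 2 of Thm. 4.6
    have hG : min vL (vN - vL) = 1 := by omega
    rw [hG, cesnaviciusNeururerSahaBraceK, if_neg one_ne_zero, if_pos ⟨rfl, c3.2⟩]
    simp
  · exact absurd c4.1 hp2
  · exact absurd c5.1 hp2
  · exact absurd c6.1 hp2
  · -- last rows
    rw [cesnaviciusNeururerSahaBraceK, if_neg (by omega), if_neg (by omega), if_neg (by omega)]
    push_cast [Nat.cast_sub hle]
    linarith

/-- Row-by-row comparison at `p = 2` (weight `2`): the Cor. 4.7 brace is at most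
`val_2(gcd(L, N/L))` plus the `p = 2` brace of Thm. 4.6 (in fact equal).
[cite: CesnaviciusNeururerSaha2023, Cor. 4.7 (p. 31)] -/
theorem cesnaviciusNeururerSahaCuspBound_two_le_add_braceTwo {vL vN : ℕ} (hle : vL ≤ vN) :
    cesnaviciusNeururerSahaCuspBound 2 vL vN ≤
      (min vL (vN - vL) : ℕ) + cesnaviciusNeururerSahaBraceTwo 2 (min vL (vN - vL)) vL vN := by
  unfold cesnaviciusNeururerSahaCuspBound
  split_ifs with c1 c2 c3 c4 c5 c6
  · -- row 1 of Cor. 4.7 / row 1 of the first display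
    have hG : min vL (vN - vL) = 0 := by omega
    rw [hG, cesnaviciusNeururerSahaBraceTwo, if_neg (by omega), if_neg (by omega), if_neg (by omega),
      if_neg (by omega), cesnaviciusNeururerSahaBraceK, if_pos rfl]
    simp
  · -- row 2 of Cor. 4.7 (`max(1/2, 1/(2-1)) = 1`) / row 1 of the `p = 2` display
    obtain ⟨rfl, rfl⟩ := c2
    rw [show min 1 (2 - 1) = 1 by norm_num, cesnaviciusNeururerSahaBraceTwo, if_pos ⟨rfl, rfl⟩]
    norm_num
  · -- row 3 of Cor. 4.7 / row 2 of the first display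
    have hG : min vL (vN - vL) = 1 := by omega
    rw [hG, cesnaviciusNeururerSahaBraceTwo, if_neg (by omega), if_neg (by omega), if_neg (by omega),
      if_neg (by omega), cesnaviciusNeururerSahaBraceK, if_neg one_ne_zero, if_pos ⟨rfl, c3.2⟩]
    simp
  · -- row 4 of Cor. 4.7 / row 2 of the `p = 2` display
    have hG : min vL (vN - vL) = vL := by omega
    rw [hG, cesnaviciusNeururerSahaBraceTwo, if_neg (by omega), if_pos ⟨c4.2.1, c4.2.2⟩]
    have h2 : (vN : ℝ) = 2 * vL := by exact_mod_cast c4.2.1.symm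
    push_cast
    linarith
  · -- row 5 of Cor. 4.7 / row 3 of the `p = 2` display
    have hG : min vL (vN - vL) = vL := by omega
    rw [hG, cesnaviciusNeururerSahaBraceTwo, if_neg (by omega), if_neg (by omega),
      if_pos ⟨c5.2.1, c5.2.2⟩]
    have h2 : (vN : ℝ) = 2 * vL := by exact_mod_cast c5.2.1.symm
    push_cast
    linarith
  · -- row 6 of Cor. 4.7 / row 4 of the `p = 2` display
    have hG : min vL (vN - vL) = 3 := by omega
    rw [hG, cesnaviciusNeururerSahaBraceTwo, if_neg (by omega), if_neg (by omega), if_neg (by omega),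
      if_pos ⟨rfl, c6.2.2⟩]
    norm_num
  · -- last row of Cor. 4.7 / last row of the first display
    rw [cesnaviciusNeururerSahaBraceTwo, if_neg (by omega), if_neg (by omega), if_neg (by omega),
      if_neg (by omega), cesnaviciusNeururerSahaBraceK, if_neg (by omega), if_neg (by omega),
      if_neg (by omega)]
    push_cast [Nat.cast_sub hle]
    linarith

/-- The weight-`2` exponent of the first display is at most the Cor. 4.7 exponent (`p` odd).
[cite: CesnaviciusNeururerSaha2023, Cor. 4.7 (p. 31) from Thm. 4.6 (p. 30)] -/
theorem cesnaviciusNeururerSaha_exponentK_two_le {p vL vN : ℕ} (hp : p.Prime) (hp2 : p ≠ 2)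
    (hle : vL ≤ vN) :
    ((2 : ℤ) : ℝ) / 2 * ((vN - min (2 * vL) vN : ℕ) : ℝ) -
        cesnaviciusNeururerSahaBraceK (min vL (vN - vL)) vL vN ≤
      ((vN - vL : ℕ) : ℝ) - cesnaviciusNeururerSahaCuspBound p vL vN := by
  have hsplit : ((vN - min (2 * vL) vN : ℕ) : ℝ) = ((vN - vL : ℕ) : ℝ) - (min vL (vN - vL) : ℕ) := by
    rw [← Nat.cast_sub (by omega)]
    congr 1
    omega
  have := cesnaviciusNeururerSahaCuspBound_le_add_braceK hp hp2 hle
  rw [hsplit]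
  push_cast at this ⊢
  linarith

/-- The weight-`2` exponent of the second display is at most the Cor. 4.7 exponent (`p = 2`).
[cite: CesnaviciusNeururerSaha2023, Cor. 4.7 (p. 31) from Thm. 4.6 (p. 30)] -/
theorem cesnaviciusNeururerSaha_exponentTwo_two_le {vL vN : ℕ} (hle : vL ≤ vN) :
    ((2 : ℤ) : ℝ) / 2 * ((vN - min (2 * vL) vN : ℕ) : ℝ) -
        cesnaviciusNeururerSahaBraceTwo 2 (min vL (vN - vL)) vL vN ≤
      ((vN - vL : ℕ) : ℝ) - cesnaviciusNeururerSahaCuspBound 2 vL vN := by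
  have hsplit : ((vN - min (2 * vL) vN : ℕ) : ℝ) = ((vN - vL : ℕ) : ℝ) - (min vL (vN - vL) : ℕ) := by
    rw [← Nat.cast_sub (by omega)]
    congr 1
    omega
  have := cesnaviciusNeururerSahaCuspBound_two_le_add_braceTwo hle
  rw [hsplit]
  push_cast at this ⊢
  linarith

/-- **Cor. 4.7 is the weight-`2` case of Thm. 4.6** ("We explicate the weight 2 case of
Theorem 4.6", p. 31): the named fact `cesnaviciusNeururerSaha_cor_4_7` of
`NewformCuspFourierValuation.lean` follows from `cesnaviciusNeururerSaha_thm_4_6` (at `p ≠ 2` from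
the first display, at `p = 2` from the second; the leading term `val_p(N/gcd(L², N))` plus
`val_p(gcd(L, N/L))` is `val_p(N/L)`).
[cite: CesnaviciusNeururerSaha2023, Cor. 4.7 (p. 31) from Thm. 4.6 (p. 30)] -/
theorem cesnaviciusNeururerSaha_cor_4_7_of_thm_4_6 (h : cesnaviciusNeururerSaha_thm_4_6) :
    cesnaviciusNeururerSaha_cor_4_7 := by
  intro N _ p _ f hf γ ι n
  have hp : p.Prime := Fact.out
  have hN : N ≠ 0 := NeZero.ne N
  have hLN : cuspDenominator N γ ∣ N := cuspDenominator_dvd N γ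
  have hle : padicValNat p (cuspDenominator N γ) ≤ padicValNat p N := padicValNat_le_of_dvd hN hLN
  have h1p : (1 : ℝ) ≤ p := by exact_mod_cast hp.one_lt.le
  obtain ⟨h1, h2⟩ := h N p 2 two_pos f hf γ ι n
  rcases eq_or_ne p 2 with hp2 | hp2
  · subst hp2
    refine (h2 rfl).trans (Real.rpow_le_rpow_of_exponent_le h1p ?_)
    rw [cesnaviciusNeururerSahaExponentTwo_eq 2 hN hLN]
    exact cesnaviciusNeururerSaha_exponentTwo_two_le hle
  · refine h1.trans (Real.rpow_le_rpow_of_exponent_le h1p ?_)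
    rw [cesnaviciusNeururerSahaExponentK_eq 2 hN hLN]
    exact cesnaviciusNeururerSaha_exponentK_two_le hp hp2 hle

end Bridge

/-! ### Unpackings of Thm. 4.6 in every weight (proved) -/

/-- **(4.5.1) in every weight**: "if `p ∤ N`, then `val_p(f|𝔠) ≥ 0`" — under the fact, for a
`ℤ`-combination `f` of weight-`k` newforms on `Γ₀(N)` and `p ∤ N`, `‖ι⁻¹(a_f(n;γ))‖ ≤ 1` at every
cusp (all valuations vanish, the exponent is `0`).
[cite: CesnaviciusNeururerSaha2023, Lemma 4.5 (4.5.1) (p. 30); Thm. 4.6] -/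
theorem norm_fourierCoeffAtCusp_le_one_of_not_dvd_of_thm_4_6 (h : cesnaviciusNeururerSaha_thm_4_6)
    {N : ℕ} [NeZero N] {p : ℕ} [Fact p.Prime] (hpN : ¬ p ∣ N) {k : ℤ} (hk : 0 < k)
    (f : CuspForm (Gamma0 N) k) (hf : f ∈ Submodule.span ℤ (newforms0 N k)) (γ : SL(2, ℤ))
    (ι : PadicAlgCl p ≃+* ℂ) (n : ℕ) :
    ‖ι.symm (fourierCoeffAtCusp N k ⇑f γ n)‖ ≤ 1 := by
  have hN : N ≠ 0 := NeZero.ne N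
  have hLN : cuspDenominator N γ ∣ N := cuspDenominator_dvd N γ
  have hvN : padicValNat p N = 0 := padicValNat.eq_zero_of_not_dvd hpN
  have hvL : padicValNat p (cuspDenominator N γ) = 0 :=
    padicValNat.eq_zero_of_not_dvd fun hd ↦ hpN (hd.trans hLN)
  have hE : cesnaviciusNeururerSahaExponentK k p N (cuspDenominator N γ) = 0 := by
    rw [cesnaviciusNeururerSahaExponentK_eq k hN hLN, hvN, hvL]
    simp [cesnaviciusNeururerSahaBraceK]
  have := (h N p k hk f hf γ ι n).1
  rwa [hE, Real.rpow_zero] at this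

/-- **Integrality at `∞` in every weight** (`γ = 1`, `L = N`: `val_p(N/gcd(N², N)) = 0` and
`val_p(gcd(N, 1)) = 0`, first row): under the fact, the `q`-expansion coefficients at `∞` of a
`ℤ`-combination of weight-`k` newforms on `Γ₀(N)` satisfy `‖ι⁻¹(a_n(f))‖ ≤ 1` for every `p` (§4.3,
p. 29: "for a normalized newform `f` on `Γ₀(N)` and every prime `p`, we have `val_p(f|∞) = 0`").
[cite: CesnaviciusNeururerSaha2023, Thm. 4.6 (p. 30) and §4.3 (p. 29)] -/
theorem norm_qExpansion_coeff_le_one_of_thm_4_6 (h : cesnaviciusNeururerSaha_thm_4_6)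
    {N : ℕ} [NeZero N] {p : ℕ} [Fact p.Prime] {k : ℤ} (hk : 0 < k) (f : CuspForm (Gamma0 N) k)
    (hf : f ∈ Submodule.span ℤ (newforms0 N k)) (ι : PadicAlgCl p ≃+* ℂ) (n : ℕ) :
    ‖ι.symm ((qExpansion 1 ⇑f).coeff n)‖ ≤ 1 := by
  have hN : N ≠ 0 := NeZero.ne N
  have hE : cesnaviciusNeururerSahaExponentK k p N N = 0 := by
    rw [cesnaviciusNeururerSahaExponentK_eq k hN dvd_rfl,
      min_eq_right (by omega : padicValNat p N ≤ 2 * padicValNat p N), Nat.sub_self,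
      min_eq_right (Nat.zero_le _)]
    simp [cesnaviciusNeururerSahaBraceK]
  have := (h N p k hk f hf 1 ι n).1
  rwa [fourierCoeffAtCusp_one, cuspDenominator_one, hE, Real.rpow_zero] at this

/-- **Squarefree level at `p` in every weight** (`val_p(N) ≤ 1`, e.g. `N` squarefree, the
semistable case): then `val_p(gcd(L, N/L)) = 0` (first row, brace `0`) and the bound reads
`‖ι⁻¹(a_f(n;γ))‖ ≤ p ^ ((k/2)(val_p(N) - val_p(L)))` — no loss at cusps of denominator divisible by
`p`, a loss of at most `p^{k/2}` at the others (proof of Thm. 4.6, p. 31: "In the case `val_p(N) = 1`,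
we have `val_p(L) ∈ {0, 1}` …"). [cite: CesnaviciusNeururerSaha2023, Thm. 4.6 and its proof (pp. 30–31)] -/
theorem norm_fourierCoeffAtCusp_le_of_padicValNat_level_le_one (h : cesnaviciusNeururerSaha_thm_4_6)
    {N : ℕ} [NeZero N] {p : ℕ} [Fact p.Prime] (hN1 : padicValNat p N ≤ 1) {k : ℤ} (hk : 0 < k)
    (f : CuspForm (Gamma0 N) k) (hf : f ∈ Submodule.span ℤ (newforms0 N k)) (γ : SL(2, ℤ))
    (ι : PadicAlgCl p ≃+* ℂ) (n : ℕ) :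
    ‖ι.symm (fourierCoeffAtCusp N k ⇑f γ n)‖ ≤
      (p : ℝ) ^ ((k : ℝ) / 2 * ((padicValNat p N - padicValNat p (cuspDenominator N γ) : ℕ) : ℝ)) := by
  have hN : N ≠ 0 := NeZero.ne N
  have hLN : cuspDenominator N γ ∣ N := cuspDenominator_dvd N γ
  have hle := padicValNat_le_of_dvd (p := p) hN hLN
  have hmin : min (padicValNat p (cuspDenominator N γ))
      (padicValNat p N - padicValNat p (cuspDenominator N γ)) = 0 := by omega
  have hlead : padicValNat p N - min (2 * padicValNat p (cuspDenominator N γ)) (padicValNat p N) =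
      padicValNat p N - padicValNat p (cuspDenominator N γ) := by omega
  have := (h N p k hk f hf γ ι n).1
  rwa [cesnaviciusNeururerSahaExponentK_eq k hN hLN, hmin, hlead, cesnaviciusNeururerSahaBraceK,
    if_pos rfl, sub_zero] at this

/-! ### Lemma 5.13 (= the "Moreover" of Thm. 1.3): `val_p(f|𝔠)` depends only on `val_p(L)` -/

/-- **Česnavičius–Neururer–Saha 2024, Lemma 5.13 (analytic content).** Printed (pp. 38–39),
verbatim: "For a prime `p`, an `f ∈ H⁰(X₀(N)_{ℚ̄_p}, ω^{⊗k})` with `k ≥ 1`, a cusp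
`𝔠 ∈ X₀(N)(ℚ̄_p)` of denominator `L`, and an isomorphism `ι : ℚ̄_p ≃ ℂ`, the valuation
`v := val_p(ι(f)|ι(𝔠))` defined as in (4.2.2) … depends only on `f` and `val_p(L)` (and not on `𝔠`,
`ι`, `Ñ`, or `𝔠̃`)", the sections of `ω^{⊗k}` over `ℂ` being the modular forms of weight `k` (§5.5,
p. 35). Rendering (module docstring): for every level `N ≥ 1`, prime `p`, weight `k ≥ 1`, modular
form `f ∈ M_k(Γ₀(N))`, ring isomorphism `ι : ℚ̄_p ≃ ℂ`, and `γ, γ' ∈ SL(2, ℤ)` whose cusps `γ∞, γ'∞`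
have denominators of the same `p`-adic valuation, every bound `‖ι⁻¹(a_f(n;γ))‖ ≤ B` (all `n`)
also holds at `γ'` — i.e. `val_p(f|γ∞) = val_p(f|γ'∞)`. FAITHFUL to the printed dependence on the
cusp; the independence of `ι` (for a fixed `ℚ̄_p`-rational `f`) and the geometric characterisation
(5.13.1) are not transcribed (`TODO(general form)`: integral model `X₀(N)_{ℤ_p}`). Named fact
(statement only). [cite: CesnaviciusNeururerSaha2023, Lemma 5.13 (pp. 38–39); Thm. 1.3 (p. 4)] -/
def cesnaviciusNeururerSaha_lemma_5_13 : Prop :=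
  ∀ (N : ℕ) [NeZero N] (p : ℕ) [Fact p.Prime] (k : ℤ), 1 ≤ k →
    ∀ (f : ModularForm (Gamma0 N) k) (ι : PadicAlgCl p ≃+* ℂ) (γ γ' : SL(2, ℤ)),
      padicValNat p (cuspDenominator N γ) = padicValNat p (cuspDenominator N γ') →
      ∀ B : ℝ, (∀ n, ‖ι.symm (fourierCoeffAtCusp N k ⇑f γ n)‖ ≤ B) →
        ∀ n, ‖ι.symm (fourierCoeffAtCusp N k ⇑f γ' n)‖ ≤ B

-- TODO(general form): Lemma 5.13 (5.13.1) "`v` is the largest rational number such that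
-- `p^{-v} f ∈ H⁰(U_{ℤ̄_p}, ω^{⊗k})`" and the independence of `ι` for `ℚ̄_p`-rational `f`.

/-- The symmetric form of Lemma 5.13: cusps whose denominators have the same `p`-adic valuation
carry the same bounds. [cite: CesnaviciusNeururerSaha2023, Lemma 5.13 (pp. 38–39)] -/
theorem forall_norm_fourierCoeffAtCusp_le_iff_of_lemma_5_13 (h : cesnaviciusNeururerSaha_lemma_5_13)
    {N : ℕ} [NeZero N] {p : ℕ} [Fact p.Prime] {k : ℤ} (hk : 1 ≤ k) (f : ModularForm (Gamma0 N) k)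
    (ι : PadicAlgCl p ≃+* ℂ) {γ γ' : SL(2, ℤ)}
    (hγ : padicValNat p (cuspDenominator N γ) = padicValNat p (cuspDenominator N γ')) (B : ℝ) :
    (∀ n, ‖ι.symm (fourierCoeffAtCusp N k ⇑f γ n)‖ ≤ B) ↔
      ∀ n, ‖ι.symm (fourierCoeffAtCusp N k ⇑f γ' n)‖ ≤ B :=
  ⟨h N p k hk f ι γ γ' hγ B, h N p k hk f ι γ' γ hγ.symm B⟩

/-! ### Thm. 1.3 (p. 4) assembled from Thm. 4.6 and Lemma 5.13 (proved) -/

/-- **Česnavičius–Neururer–Saha 2024, Thm. 1.3** ("Theorem 4.6 and Lemma 5.13", p. 4): for a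
normalized newform `f` of weight `k` on `Γ₀(N)` (`f ∈ newforms0 N k`), a prime `p`, `ι : ℚ̄_p ≃ ℂ`
and a cusp `γ∞` of denominator `L`: the Fourier coefficients `a_f(r; 𝔠)` satisfy the two displays
(`‖ι⁻¹(a_f(r;γ))‖ ≤ p ^ E` for all `r`, and `≤ p ^ E₂` if `p = 2`), and "Moreover,
`min_r(val_p(a_f(r; 𝔠)))` only depends on `f` and `L`, and not on the cusp `𝔠` with denominator
`L`" (any `γ'` with the same denominator carries the same bounds). Derived from the two named facts.
[cite: CesnaviciusNeururerSaha2023, Thm. 1.3 (pp. 4–5)] -/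
theorem cesnaviciusNeururerSaha_thm_1_3 (h46 : cesnaviciusNeururerSaha_thm_4_6)
    (h513 : cesnaviciusNeururerSaha_lemma_5_13) {N : ℕ} [NeZero N] {p : ℕ} [Fact p.Prime]
    {k : ℤ} (hk : 0 < k) {f : CuspForm (Gamma0 N) k} (hf : f ∈ newforms0 N k) (γ : SL(2, ℤ))
    (ι : PadicAlgCl p ≃+* ℂ) :
    (∀ r, ‖ι.symm (fourierCoeffAtCusp N k ⇑f γ r)‖ ≤
        (p : ℝ) ^ cesnaviciusNeururerSahaExponentK k p N (cuspDenominator N γ)) ∧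
    (p = 2 → ∀ r, ‖ι.symm (fourierCoeffAtCusp N k ⇑f γ r)‖ ≤
        (p : ℝ) ^ cesnaviciusNeururerSahaExponentTwo k p N (cuspDenominator N γ)) ∧
    (∀ γ' : SL(2, ℤ), cuspDenominator N γ' = cuspDenominator N γ → ∀ B : ℝ,
      ((∀ r, ‖ι.symm (fourierCoeffAtCusp N k ⇑f γ r)‖ ≤ B) ↔
        ∀ r, ‖ι.symm (fourierCoeffAtCusp N k ⇑f γ' r)‖ ≤ B)) := by
  have hf' : f ∈ Submodule.span ℤ (newforms0 N k) := Submodule.subset_span hf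
  refine ⟨fun r ↦ (h46 N p k hk f hf' γ ι r).1, fun hp r ↦ (h46 N p k hk f hf' γ ι r).2 hp,
    fun γ' hγ' B ↦ ?_⟩
  exact forall_norm_fourierCoeffAtCusp_le_iff_of_lemma_5_13 h513 (by omega)
    (ModularFormClass.modularForm f) ι (congrArg _ hγ'.symm) B

/-! ### The printed width formula `w(𝔠) = N/gcd(L², N)` and left `Γ₀(N)`-invariance of the
### Fourier expansion at a cusp (ČNS §4.1–4.2; appended 2026-08-26, theorems only) -/

section WidthAndInvariance

open Literature.NumberTheory.Automorphic (Fuchsian.cuspWidth)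

variable (N : ℕ)

/-- `gcd(N, c²) = gcd(gcd(c, N)², N)` (prime by prime: `min(v_N, 2v_c) = min(2 min(v_c, v_N), v_N)`).
Private arithmetic helper. [folklore] -/
private theorem gcd_level_sq_eq (N c : ℕ) : Nat.gcd N (c ^ 2) = Nat.gcd (Nat.gcd c N ^ 2) N := by
  rcases eq_or_ne N 0 with rfl | hN
  · simp
  rcases eq_or_ne c 0 with rfl | hc
  · rw [zero_pow two_ne_zero, Nat.gcd_zero_right, Nat.gcd_zero_left, Nat.gcd_comm,
      Nat.gcd_eq_left (dvd_pow_self N two_ne_zero)]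
  have hg : Nat.gcd c N ≠ 0 := Nat.gcd_ne_zero_right hN
  refine (Nat.eq_iff_prime_padicValNat_eq _ _ (Nat.gcd_ne_zero_left hN)
    (Nat.gcd_ne_zero_right hN)).mpr fun p hp ↦ ?_
  haveI := Fact.mk hp
  rw [padicValNat_gcd_eq_min hN (pow_ne_zero 2 hc), padicValNat_gcd_eq_min (pow_ne_zero 2 hg) hN,
    padicValNat.pow, padicValNat.pow, padicValNat_gcd_eq_min hc hN]
  omega

/-- **The printed width formula** (ČNS §4.1, p. 28: "The width of a cusp `𝔠` is the smallest
`w(𝔠) ∈ ℤ_{>0}` such that `γ (1 w(𝔠); 0 1) γ⁻¹ ∈ Γ₀(N)` …, explicitly, `w(𝔠) = N/gcd(L², N)`"): the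
tree's width `Fuchsian.cuspWidth N c = N/gcd(N, c²)` of the cusp `γ∞`, `c = γ₁₀` (PROVED minimal
by `Fuchsian.conj_T_zpow_mem_Gamma0_iff`), IS `N/gcd(L², N)` with `L = cuspDenominator N γ` — the
identity asserted in the module docstring of `NewformCuspFourierValuation.lean`, now proved.
[cite: CesnaviciusNeururerSaha2023, §4.1 (p. 28)] -/
theorem cuspWidth_eq_level_div_gcd_sq (γ : SL(2, ℤ)) :
    Fuchsian.cuspWidth N ((γ : Matrix (Fin 2) (Fin 2) ℤ) 1 0) =
      N / Nat.gcd (cuspDenominator N γ ^ 2) N := by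
  rw [Fuchsian.cuspWidth, cuspDenominator, gcd_level_sq_eq]

/-- The width is an invariant of the cusp `Γ₀(N)γ∞`: `w((δγ)∞) = w(γ∞)` for `δ ∈ Γ₀(N)` (by the
printed formula and the invariance of the denominator, `cuspDenominator_mul_left_of_mem_Gamma0`).
[cite: CesnaviciusNeururerSaha2023, §4.1 (p. 28)] -/
theorem cuspWidth_mul_left_of_mem_Gamma0 [NeZero N] {δ : SL(2, ℤ)} (hδ : δ ∈ Gamma0 N)
    (γ : SL(2, ℤ)) :
    Fuchsian.cuspWidth N (((δ * γ : SL(2, ℤ)) : Matrix (Fin 2) (Fin 2) ℤ) 1 0) =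
      Fuchsian.cuspWidth N ((γ : Matrix (Fin 2) (Fin 2) ℤ) 1 0) := by
  rw [cuspWidth_eq_level_div_gcd_sq, cuspWidth_eq_level_div_gcd_sq,
    cuspDenominator_mul_left_of_mem_Gamma0 N hδ]

/-- **The Fourier expansion at a cusp depends on the representative `γ` only through `Γ₀(N)γ`** (ČNS
§4.2, p. 29: "For every modular form `f` of weight `k` on `Γ₀(N)` and every cusp `𝔠 = γ∞` with
`γ ∈ SL₂(ℤ)`, … `(f|_kγ)(z) = ∑ a_f(n;γ) e^{2πinz/w(𝔠)}`, which depends not only on `𝔠` but also on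
`γ`" — only through the right coset by `{±(1 *; 0 1)}`, by roots of unity; on the LEFT, `f|_k(δγ) =
(f|_kδ)|_kγ = f|_kγ` for `δ ∈ Γ₀(N)`): for any `Γ₀(N)`-invariant `f` of weight `k`
(`SlashInvariantFormClass`, e.g. `ModularForm`/`CuspForm (Gamma0 N) k`), `a_f(n; δγ) = a_f(n; γ)`.
[cite: CesnaviciusNeururerSaha2023, §4.2 (p. 29)] -/
theorem fourierCoeffAtCusp_mul_left_of_mem_Gamma0 [NeZero N] (k : ℤ) {F : Type*} [FunLike F ℍ ℂ]
    [SlashInvariantFormClass F (Gamma0 N) k] (f : F) {δ : SL(2, ℤ)} (hδ : δ ∈ Gamma0 N)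
    (γ : SL(2, ℤ)) (n : ℕ) :
    fourierCoeffAtCusp N k ⇑f (δ * γ) n = fourierCoeffAtCusp N k ⇑f γ n := by
  have hδ' : (⇑f) ∣[k] δ = ⇑f := by
    rw [ModularForm.SL_slash]
    exact SlashInvariantForm.slash_action_eqn f _ (Subgroup.mem_map.mpr ⟨δ, hδ, rfl⟩)
  have hslash : (⇑f) ∣[k] (δ * γ) = (⇑f) ∣[k] γ := by
    rw [SlashAction.slash_mul, hδ']
  unfold fourierCoeffAtCusp
  rw [hslash, cuspWidth_mul_left_of_mem_Gamma0 N hδ]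

/-- Hence every statement "`‖ι⁻¹(a_f(n;γ))‖ ≤ B` for all `n`" (the form in which `val_p(f|𝔠) ≥ -log_p B`
is transcribed in this file and its predecessor) is a statement about the cusp `𝔠 = Γ₀(N)γ∞`
(ČNS (4.2.2): "`val_p(f|𝔠)` … depends only on `f` and `𝔠`, and not on `γ`" — the left-coset half;
the right `{±(1 *; 0 1)}`-coset changes `a_f(n;γ)` by roots of unity, of norm `1`, not transcribed).
[cite: CesnaviciusNeururerSaha2023, §4.2 (4.2.2) (p. 29)] -/
theorem forall_norm_fourierCoeffAtCusp_le_iff_of_mem_Gamma0 [NeZero N] {p : ℕ} [Fact p.Prime]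
    (k : ℤ) {F : Type*} [FunLike F ℍ ℂ] [SlashInvariantFormClass F (Gamma0 N) k] (f : F)
    (ι : PadicAlgCl p ≃+* ℂ) {δ : SL(2, ℤ)} (hδ : δ ∈ Gamma0 N) (γ : SL(2, ℤ)) (B : ℝ) :
    (∀ n, ‖ι.symm (fourierCoeffAtCusp N k ⇑f (δ * γ) n)‖ ≤ B) ↔
      ∀ n, ‖ι.symm (fourierCoeffAtCusp N k ⇑f γ n)‖ ≤ B := by
  simp_rw [fourierCoeffAtCusp_mul_left_of_mem_Gamma0 N k f hδ]

end WidthAndInvariance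

end Literature.NumberTheory.EllipticCurves.ModularForms

end
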